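import Literature.NumberTheory.ComplexMultiplication.FiniteQAlgebraLatticeInvertibleClassesFinite
import HarnessLib

/-!
# TWO BIJECTIONS OF `ε`-CLASS GROUPS: `G([Λ]_ε) ≅ G([pr_FΛ]_ε)` (Hertling–Larabi 2026 Thm. 9.2 ∕ 2026b Thm. 5.10 —
# (9.7) is an ISOMORPHISM, «the equality of the sizes of the two groups is new», Rem. 9.3 (iii)) and
# `G([Λ]_ε) → [[L_1]_ε]_w`, `[L_3]_ε ↦ [L_3L_1]_ε` (2026 Thm. 5.8 ∕ 2026b Thm. 5.5 (d) (5.13)), whence every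
# `w`-class of `ε`-classes is finite (Rem. 9.3 (iv), 2026b Rem. 5.6 (i)) — def-free, as equalities of `Nat.card`

[topic NumberTheory/ComplexMultiplication] General-`A` series (namespace
`Literature.NumberTheory.ComplexMultiplication.FiniteQAlgebraLattice`); sequel of
`FiniteQAlgebraLatticeRadicalProjection` (Thm. 9.2 SURJECTIVITY `exists_invertible_map_eq`, Lemma 9.1 (c)
`map_invertible_of_mul_div_div_eq`), `FiniteQAlgebraLatticeRadicalProjectionInjective` (Thm. 9.2 INJECTIVITY
[Fa68]), `FiniteQAlgebraLatticeInvertibleClassesFinite` (`G([Λ]_ε)` finite, Rem. 9.3 (iii)) and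
`FiniteQAlgebraLatticeWeakEquivalence` (Thm. 5.7, 5.8: `w`-equivalence, `L_3 = L_2:L_1` uniqueness).  Lane
`lit-hodgefound` (Track 2 foundations library), seat p19 generation 37, row g37-#9.  THEOREMS ONLY: no definition,
no instance, no notation, no named fact (D-0026, net Literature debt `0`), no `sorry`.

DEF-FREE SPELLING (as in the files above).  `G([Λ]_ε)` is the quotient type
`Quot fun L L' : {L // IsFullLattice A L ∧ L / L = Λ ∧ L * ((L / L) / L) = L / L} => ∃ u : Aˣ, u • L.1 = L'.1`;
the `w`-class of `ε`-classes `[[L_1]_ε]_w = {[L_2]_ε | L_2 ∼_w L_1}` is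
`Quot fun L L' : {L_2 // IsFullLattice A L_2 ∧ 1 ∈ (L_1 / L_2) * (L_2 / L_1)} => ∃ u : Aˣ, u • L.1 = L'.1`;
«bijection» ∕ «isomorphism» ∕ «same size» is `Nat.card _ = Nat.card _` (proved through an explicit `Equiv`
induced by `L ↦ πL`, resp. `L_3 ↦ L_3L_1`); `π(M)` is `M.map (π : A →+ B).toIntLinearMap`, and HL's
`pr_F : A = F ⊕ R → F`, `F ⊂ A` is a ring homomorphism `π : A → B` with nil kernel and a multiplicative section
`σ : B → A` (`π ∘ σ = id`).

## Sources, VERBATIM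

C. Hertling, K. Larabi, *Semigroups from full lattices in commutative ℚ-algebras*, arXiv:2602.14973 (2026)
[HertlingLarabi2026], held `paper:arxiv-2602.14973`, §9 (chunk p0024): «`G([Λ]_ε) → G([Λ_0]_ε),
[L]_ε ↦ [pr_FL]_ε` (9.7). […] **Theorem 9.2.** The group homomorphism in (9.6) is surjective. The group
homomorphism in (9.7) is an isomorphism. […] **Remarks 9.3.** […] (iii) The second group `G([Λ_0]_ε)` in (9.7) is
finite by the Jordan-Zassenhaus Theorem 6.3. Therefore also the first group `G([Λ]_ε)` in (9.7) is finite. We know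
this already from Theorem 6.5. But the equality of the sizes of the two groups is new. (iv) By (5.13) any
`w`-equivalence class of `ε`-classes `[L]_ε` of full lattices `L` with `𝒪(L) = Λ` is in bijection to `G([Λ]_ε)`,
so finite.»; §5 Thm. 5.8 (chunk p0013): «(a) […] The only full lattice `L_3 ∈ G(𝒪(L_1))` with `L_1L_3 = L_2` is
`L_3 = L_2:L_1`. (b) Let `Λ` be an order and `L_1 ∈ 𝓛(A)` with `𝒪(L_1) = Λ`. Then `G(Λ) = [Λ]_w` and
`G([Λ]_ε) = [[Λ]_ε]_w` (5.11). The maps `G(Λ) → [L_1]_w, L_3 ↦ L_3L_1` (5.12), `G([Λ]_ε) → [[L_1]_ε]_w,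
[L_3]_ε ↦ [L_3]_ε[L_1]_ε` (5.13), are well defined and bijections.»

C. Hertling, K. Larabi, *Conjugacy classes of regular integer matrices*, arXiv:2602.15748 (2026)
[HertlingLarabi2026b], held `paper:arxiv-2602.15748`, §5 (chunks p0009–p0010): «**Theorem 5.5** […] (d) Let `Λ`
be an order and `L_1 ∈ 𝓛(A)` with `𝒪(L_1) = Λ`. Then `G(Λ) = [Λ]_w` and `G([Λ]_ε) = [[Λ]_ε]_w` (5.2). The maps
`G(Λ) → [L_1]_w, L_3 ↦ L_3L_1`, `G([Λ]_ε) → [[L_1]_ε]_w, [L_3]_ε ↦ [L_3]_ε[L_1]_ε` (5.3), are well defined and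
bijections. **Remarks 5.6.** (i) Let `Λ` be an order. By (5.3) the finite set `{[L]_ε | L ∈ 𝓛(A), 𝒪(L) = Λ}`
splits into finitely many `w`-classes. One of them is the (thus finite) group `G([Λ]_ε)`. These `w`-classes have
all the same size, because (5.3) gives bijections from the finite group `G([Λ]_ε)` to any other `w`-class in the
finite set `{[L]_ε | L ∈ 𝓛(A), 𝒪(L) = Λ}`. […] the finite group `G([Λ]_ε)` for an order `Λ` in `A` is isomorphic
to the finite group `G([Λ_0]_ε)` for the induced order `Λ_0 = pr_FΛ` in the separable part `F` of `A`. […]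
**Theorem 5.10** (Fa68) [HL26]. […] The group homomorphism in (5.17) is an isomorphism.»

## What is proved

* §1 **THEOREM 9.2 ∕ 5.10, (9.7) is a BIJECTION** for a ring homomorphism `π : A → B` with nil kernel and a
  multiplicative section `σ`: **`natCard_quot_invertible_eq_natCard_quot_invertible_map`** —
  `|G([Λ]_ε)| = |G([πΛ]_ε)|` (as `Nat.card`; injective by [Fa68], `FiniteQAlgebraLatticeRadicalProjectionInjective`,
  surjective by `exists_invertible_map_eq`), and `finite_quot_invertible_iff_finite_quot_invertible_map`.
* §2 **THEOREM 5.8 (b) (5.13) ∕ 5.5 (d) (5.3)**: **`natCard_quot_invertible_eq_natCard_quot_weak`** —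
  `[L_3]_ε ↦ [L_3L_1]_ε` is a bijection `G([𝒪(L_1)]_ε) → [[L_1]_ε]_w` for every full `L_1` (well defined by
  `u(L_3L_1) = (uL_3)L_1`; injective by the uniqueness `L_3 = L_2:L_1`, Thm. 5.8 (a); surjective by `L_3 := L_2:L_1`,
  Thm. 5.7 (b)); REMARKS 9.3 (iv) ∕ 5.6 (i): **`finite_quot_weak`** — for every finite-dimensional commutative
  `ℚ`-algebra `A`, every `w`-class of `ε`-classes of full lattices is FINITE (of size `|G([𝒪(L_1)]_ε)|`).

## References

* [HertlingLarabi2026] C. Hertling, K. Larabi, arXiv:2602.14973 (2026), §9 Thm. 9.2, Rem. 9.3 (iii)(iv) (chunk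
  p0024), §5 Thm. 5.8 (chunk p0013). [cite: HertlingLarabi2026, §9 Thm. 9.2 and Rem. 9.3 (iii)(iv), chunk p0024]
* [HertlingLarabi2026b] C. Hertling, K. Larabi, arXiv:2602.15748 (2026), §5 Thm. 5.5 (d), Rem. 5.6 (i), Thm. 5.10
  (chunks p0009–p0010). [cite: HertlingLarabi2026b, §5 Thm. 5.5 (d) and Rem. 5.6 (i), chunk p0009]
* [Faddeev1968] D. K. Faddeev, Equivalence of systems of integer matrices, Amer. Math. Soc. Transl. (2) 71 (1968)
  43–48 (as cited by [HertlingLarabi2026] Thm. 9.2). [cite: Faddeev1968, as cited by HertlingLarabi2026 §9 Thm. 9.2]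
-/

noncomputable section

open scoped Pointwise
open Module Function Submodule

open Literature.NumberTheory.Automorphic (IsFullLattice mem_units_smul_submodule_iff)
open Literature.LinearAlgebra.Matrix.LatimerMacDuffeeSquarefree (equivalence_exists_units_smul)

namespace Literature.NumberTheory.ComplexMultiplication.FiniteQAlgebraLattice

/-! ## §1 Theorem 9.2 ∕ 5.10: `[L]_ε ↦ [πL]_ε` is a bijection `G([Λ]_ε) → G([πΛ]_ε)` -/

section Iso

variable {A B : Type} [CommRing A] [CommRing B] [Algebra ℚ A] [Algebra ℚ B]

/-- The bijection (9.7) as an `Equiv` of the class types. [folklore] -/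
private theorem nonempty_equiv_quot_invertible_map {π : A →+* B} {σ : B →+* A} (hσ : ∀ b, π (σ b) = b)
    (hnil : ∀ x, π x = 0 → IsNilpotent x)
    {Λ : Submodule ℤ A} (hΛ : IsFullLattice A Λ) (h1 : (1 : A) ∈ Λ) (hΛΛ : Λ * Λ ≤ Λ) :
    Nonempty ((Quot fun L L' : {L : Submodule ℤ A //
        IsFullLattice A L ∧ L / L = Λ ∧ L * ((L / L) / L) = L / L} => ∃ u : Aˣ, u • L.1 = L'.1) ≃
      Quot fun M M' : {M : Submodule ℤ B // IsFullLattice B M ∧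
        M / M = Λ.map (π : A →+ B).toIntLinearMap ∧ M * ((M / M) / M) = M / M} =>
          ∃ u : Bˣ, u • M.1 = M'.1) := by
  have hπ : Surjective π := fun b => ⟨σ b, hσ b⟩
  -- `πL ∈ G(πΛ)` (Lemma 9.1 (c))
  have hP : ∀ L : Submodule ℤ A, IsFullLattice A L ∧ L / L = Λ ∧ L * ((L / L) / L) = L / L →
      IsFullLattice B (L.map (π : A →+ B).toIntLinearMap) ∧
        L.map (π : A →+ B).toIntLinearMap / L.map (π : A →+ B).toIntLinearMap =
          Λ.map (π : A →+ B).toIntLinearMap ∧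
        L.map (π : A →+ B).toIntLinearMap *
            ((L.map (π : A →+ B).toIntLinearMap / L.map (π : A →+ B).toIntLinearMap) /
              L.map (π : A →+ B).toIntLinearMap) =
          L.map (π : A →+ B).toIntLinearMap / L.map (π : A →+ B).toIntLinearMap := by
    rintro L ⟨hL, hO, hinv⟩
    obtain ⟨h₁, h₂, -⟩ := map_invertible_of_mul_div_div_eq hπ hL hinv
    exact ⟨isFullLattice_map_of_surjective hπ hL, by rw [h₂, hO], h₁⟩
  obtain ⟨F, hF1⟩ : ∃ F : {L : Submodule ℤ A // IsFullLattice A L ∧ L / L = Λ ∧ L * ((L / L) / L) = L / L} →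
      {M : Submodule ℤ B // IsFullLattice B M ∧
        M / M = Λ.map (π : A →+ B).toIntLinearMap ∧ M * ((M / M) / M) = M / M},
      ∀ L, (F L).1 = L.1.map (π : A →+ B).toIntLinearMap :=
    ⟨fun L => ⟨_, hP L.1 L.2⟩, fun L => rfl⟩
  have hF : ∀ ⦃L₁ L₂ : {L : Submodule ℤ A // IsFullLattice A L ∧ L / L = Λ ∧ L * ((L / L) / L) = L / L}⦄,
      (∃ u : Aˣ, u • L₁.1 = L₂.1) → ∃ u' : Bˣ, u' • (F L₁).1 = (F L₂).1 := by
    rintro L₁ L₂ ⟨u, hu⟩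
    exact ⟨Units.map (π : A →* B) u, by rw [hF1, hF1, ← hu, map_units_smul]⟩
  refine ⟨Equiv.ofBijective (Quot.map F hF :
      Quot (fun L L' : {L : Submodule ℤ A // IsFullLattice A L ∧ L / L = Λ ∧ L * ((L / L) / L) = L / L} =>
          ∃ u : Aˣ, u • L.1 = L'.1) →
        Quot fun M M' : {M : Submodule ℤ B // IsFullLattice B M ∧
          M / M = Λ.map (π : A →+ B).toIntLinearMap ∧ M * ((M / M) / M) = M / M} =>
            ∃ u : Bˣ, u • M.1 = M'.1) ⟨?_, ?_⟩⟩
  · -- injective [Fa68]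
    rintro ⟨L₁⟩ ⟨L₂⟩ h
    obtain ⟨u', hu'⟩ := (equivalence_exists_units_smul _).eqvGen_iff.1 (Quot.eqvGen_exact h)
    rw [hF1, hF1] at hu'
    obtain ⟨u, hu⟩ := exists_units_smul_eq_of_map_eq_units_smul_map_of_div_self_eq hπ hnil L₁.2.1 L₂.2.1
      L₁.2.2.2 L₂.2.2.2 (L₁.2.2.1.trans L₂.2.2.1.symm) hu'.symm
    exact Quot.sound ⟨u, hu⟩
  · -- surjective (Thm. 9.2, first part)
    rintro ⟨M⟩
    obtain ⟨L, hL, hO, hinv, hLM⟩ := exists_invertible_map_eq hσ hΛ h1 hΛΛ M.2.1 M.2.2.1 M.2.2.2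
    exact ⟨Quot.mk _ ⟨L, hL, hO, hinv⟩, congrArg (Quot.mk _) (Subtype.ext ((hF1 _).trans hLM))⟩

/-- **THEOREM 9.2 ∕ 5.10 [Fa68] [HL26]: `[L]_ε ↦ [πL]_ε` is a BIJECTION `G([Λ]_ε) → G([πΛ]_ε)` — in particular
`|G([Λ]_ε)| = |G([πΛ]_ε)|** («The group homomorphism in (9.7) is an isomorphism […] the equality of the sizes of
the two groups is new»), for an order `Λ`, a ring homomorphism `π : A → B` whose kernel consists of nilpotent
elements and a multiplicative section `σ` of `π` (HL: `pr_F : F ⊕ R → F`, `F ⊂ A`); here as the equality of the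
cardinalities `Nat.card` of the two class types (injective by Faddeev's theorem, surjective by Thm. 9.2's
localization argument `exists_invertible_map_eq`). [cite: HertlingLarabi2026, §9 Thm. 9.2 and Rem. 9.3 (iii), chunk p0024]
[cite: HertlingLarabi2026b, §5 Thm. 5.10 («The group homomorphism in (5.17) is an isomorphism»), chunk p0010]
[cite: Faddeev1968, as cited by HertlingLarabi2026 §9 Thm. 9.2] -/
theorem natCard_quot_invertible_eq_natCard_quot_invertible_map {π : A →+* B} {σ : B →+* A}
    (hσ : ∀ b, π (σ b) = b) (hnil : ∀ x, π x = 0 → IsNilpotent x)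
    {Λ : Submodule ℤ A} (hΛ : IsFullLattice A Λ) (h1 : (1 : A) ∈ Λ) (hΛΛ : Λ * Λ ≤ Λ) :
    Nat.card (Quot fun L L' : {L : Submodule ℤ A //
        IsFullLattice A L ∧ L / L = Λ ∧ L * ((L / L) / L) = L / L} => ∃ u : Aˣ, u • L.1 = L'.1) =
      Nat.card (Quot fun M M' : {M : Submodule ℤ B // IsFullLattice B M ∧
        M / M = Λ.map (π : A →+ B).toIntLinearMap ∧ M * ((M / M) / M) = M / M} =>
          ∃ u : Bˣ, u • M.1 = M'.1) := by
  obtain ⟨e⟩ := nonempty_equiv_quot_invertible_map hσ hnil hΛ h1 hΛΛ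
  exact Nat.card_congr e

/-- **THEOREM 9.2 ∕ 5.10: `G([Λ]_ε)` is finite iff `G([πΛ]_ε)` is finite** (for `π` with nil kernel and a
multiplicative section; both sides ARE finite when `A` is finite-dimensional, Rem. 9.3 (iii),
`FiniteQAlgebraLatticeInvertibleClassesFinite.finite_quot_invertible`). [cite: HertlingLarabi2026, §9 Thm. 9.2 and Rem. 9.3 (iii), chunk p0024] -/
theorem finite_quot_invertible_iff_finite_quot_invertible_map {π : A →+* B} {σ : B →+* A}
    (hσ : ∀ b, π (σ b) = b) (hnil : ∀ x, π x = 0 → IsNilpotent x)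
    {Λ : Submodule ℤ A} (hΛ : IsFullLattice A Λ) (h1 : (1 : A) ∈ Λ) (hΛΛ : Λ * Λ ≤ Λ) :
    Finite (Quot fun L L' : {L : Submodule ℤ A //
        IsFullLattice A L ∧ L / L = Λ ∧ L * ((L / L) / L) = L / L} => ∃ u : Aˣ, u • L.1 = L'.1) ↔
      Finite (Quot fun M M' : {M : Submodule ℤ B // IsFullLattice B M ∧
        M / M = Λ.map (π : A →+ B).toIntLinearMap ∧ M * ((M / M) / M) = M / M} =>
          ∃ u : Bˣ, u • M.1 = M'.1) := by
  obtain ⟨e⟩ := nonempty_equiv_quot_invertible_map hσ hnil hΛ h1 hΛΛ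
  exact ⟨fun _ => Finite.of_equiv _ e, fun _ => Finite.of_equiv _ e.symm⟩

end Iso

/-! ## §2 Theorem 5.8 (b) (5.13): `[L_3]_ε ↦ [L_3L_1]_ε` is a bijection `G([𝒪(L_1)]_ε) → [[L_1]_ε]_w` -/

section WeakClass

variable {A : Type} [CommRing A] [Algebra ℚ A]

/-- The bijection (5.13) as an `Equiv` of the class types. [folklore] -/
private theorem nonempty_equiv_quot_weak {L₁ : Submodule ℤ A} (hL₁ : IsFullLattice A L₁) :
    Nonempty ((Quot fun L L' : {L : Submodule ℤ A //
        IsFullLattice A L ∧ L / L = L₁ / L₁ ∧ L * ((L / L) / L) = L / L} => ∃ u : Aˣ, u • L.1 = L'.1) ≃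
      Quot fun L L' : {L₂ : Submodule ℤ A //
        IsFullLattice A L₂ ∧ (1 : A) ∈ (L₁ / L₂) * (L₂ / L₁)} => ∃ u : Aˣ, u • L.1 = L'.1) := by
  -- `L₃L₁` is full and weakly equivalent to `L₁`
  have hP : ∀ L₃ : Submodule ℤ A, IsFullLattice A L₃ ∧ L₃ / L₃ = L₁ / L₁ ∧ L₃ * ((L₃ / L₃) / L₃) = L₃ / L₃ →
      IsFullLattice A (L₃ * L₁) ∧ (1 : A) ∈ (L₁ / (L₃ * L₁)) * ((L₃ * L₁) / L₁) := by
    rintro L₃ ⟨hL₃, hO, hinv⟩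
    exact ⟨isFullLattice_mul hL₃ hL₁, one_mem_div_mul_div_of_invertible_mul_eq hO hinv (mul_comm L₁ L₃)⟩
  obtain ⟨F, hF1⟩ : ∃ F : {L : Submodule ℤ A //
        IsFullLattice A L ∧ L / L = L₁ / L₁ ∧ L * ((L / L) / L) = L / L} →
      {L₂ : Submodule ℤ A // IsFullLattice A L₂ ∧ (1 : A) ∈ (L₁ / L₂) * (L₂ / L₁)},
      ∀ L₃, (F L₃).1 = L₃.1 * L₁ :=
    ⟨fun L₃ => ⟨_, hP L₃.1 L₃.2⟩, fun _ => rfl⟩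
  have hF : ∀ ⦃a b : {L : Submodule ℤ A //
      IsFullLattice A L ∧ L / L = L₁ / L₁ ∧ L * ((L / L) / L) = L / L}⦄,
      (∃ u : Aˣ, u • a.1 = b.1) → ∃ u : Aˣ, u • (F a).1 = (F b).1 := by
    rintro a b ⟨u, hu⟩
    exact ⟨u, by rw [hF1, hF1, ← hu, units_smul_mul]⟩
  refine ⟨Equiv.ofBijective (Quot.map F hF :
      Quot (fun L L' : {L : Submodule ℤ A //
          IsFullLattice A L ∧ L / L = L₁ / L₁ ∧ L * ((L / L) / L) = L / L} => ∃ u : Aˣ, u • L.1 = L'.1) →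
        Quot fun L L' : {L₂ : Submodule ℤ A //
          IsFullLattice A L₂ ∧ (1 : A) ∈ (L₁ / L₂) * (L₂ / L₁)} => ∃ u : Aˣ, u • L.1 = L'.1) ⟨?_, ?_⟩⟩
  · -- injective: `uL₃L₁ = L₃'L₁ ⟹ uL₃ = (L₃'L₁):L₁ = L₃'` (Thm. 5.8 (a))
    rintro ⟨a⟩ ⟨b⟩ h
    obtain ⟨u, hu⟩ := (equivalence_exists_units_smul _).eqvGen_iff.1 (Quot.eqvGen_exact h)
    rw [hF1, hF1, units_smul_mul] at hu
    refine Quot.sound ⟨u, ?_⟩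
    have ha : u • a.1 = (b.1 * L₁) / L₁ :=
      eq_div_of_invertible_mul_eq (by rw [div_self_units_smul, a.2.2.1]) (units_smul_mul_div_div_eq u a.2.2.2)
        (by rw [mul_comm, hu])
    have hb : b.1 = (b.1 * L₁) / L₁ := eq_div_of_invertible_mul_eq b.2.2.1 b.2.2.2 (mul_comm _ _)
    rw [ha, ← hb]
  · -- surjective: `L₃ := L₂:L₁ ∈ G(𝒪(L₁))`, `(L₂:L₁)L₁ = L₂` (Thm. 5.7 (b))
    rintro ⟨L₂⟩
    obtain ⟨hL₂, h⟩ := L₂.2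
    have h' : (1 : A) ∈ (L₂.1 / L₁) * (L₁ / L₂.1) := by rwa [mul_comm]
    have hO₃ : (L₂.1 / L₁) / (L₂.1 / L₁) = L₁ / L₁ := by
      rw [div_self_div_eq_div_self_of_one_mem h', div_self_eq_div_self_of_one_mem h]
    exact ⟨Quot.mk _ ⟨L₂.1 / L₁, isFullLattice_div hL₂ hL₁, hO₃, div_mul_inv_eq_of_one_mem h'⟩,
      congrArg (Quot.mk _) (Subtype.ext ((hF1 _).trans (div_mul_eq_of_one_mem h)))⟩

/-- **THEOREM 5.8 (b) (5.13) ∕ 5.5 (d) (5.3): `G([Λ]_ε) → [[L_1]_ε]_w`, `[L_3]_ε ↦ [L_3L_1]_ε`, is a BIJECTION**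
for every full lattice `L_1` with `𝒪(L_1) = Λ` («The maps […] `G([Λ]_ε) → [[L_1]_ε]_w, [L_3]_ε ↦ [L_3]_ε[L_1]_ε`,
are well defined and bijections»; REMARKS 5.6 (i): «These `w`-classes have all the same size, because (5.3) gives
bijections from the finite group `G([Λ]_ε) to any other `w`-class»`) — here as `|G([𝒪(L_1)]_ε)| = |[[L_1]_ε]_w|`
(`Nat.card`; well defined as `u(L_3L_1) = (uL_3)L_1`, injective by the uniqueness `L_3 = L_2:L_1` of Thm. 5.8 (a),
surjective by `L_3 = L_2:L_1 ∈ G(Λ)`, Thm. 5.7 (b)). [cite: HertlingLarabi2026, §5 Thm. 5.8 (b) (5.13), chunk p0013]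
[cite: HertlingLarabi2026b, §5 Thm. 5.5 (d) (5.3) and Rem. 5.6 (i), chunk p0009] -/
theorem natCard_quot_invertible_eq_natCard_quot_weak {L₁ : Submodule ℤ A} (hL₁ : IsFullLattice A L₁) :
    Nat.card (Quot fun L L' : {L : Submodule ℤ A //
        IsFullLattice A L ∧ L / L = L₁ / L₁ ∧ L * ((L / L) / L) = L / L} => ∃ u : Aˣ, u • L.1 = L'.1) =
      Nat.card (Quot fun L L' : {L₂ : Submodule ℤ A //
        IsFullLattice A L₂ ∧ (1 : A) ∈ (L₁ / L₂) * (L₂ / L₁)} => ∃ u : Aˣ, u • L.1 = L'.1) := by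
  obtain ⟨e⟩ := nonempty_equiv_quot_weak hL₁
  exact Nat.card_congr e

/-- **REMARKS 9.3 (iv) ∕ 5.6 (i): every `w`-class of `ε`-classes of full lattices is FINITE** — for every
finite-dimensional commutative `ℚ`-algebra `A` and every full lattice `L_1`, the `ε`-classes of the full lattices
`L_2 ∼_w L_1` form a finite set («By (5.13) any `w`-equivalence class of `ε`-classes `[L]_ε` of full lattices `L`
with `𝒪(L) = Λ` is in bijection to `G([Λ]_ε)`, so finite»; `G([𝒪(L_1)]_ε)` is finite by Rem. 9.3 (iii),
`FiniteQAlgebraLatticeInvertibleClassesFinite.finite_quot_invertible`).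
[cite: HertlingLarabi2026, §9 Rem. 9.3 (iv), chunk p0024] [cite: HertlingLarabi2026b, §5 Rem. 5.6 (i), chunk p0009] -/
theorem finite_quot_weak [Module.Finite ℚ A] {L₁ : Submodule ℤ A} (hL₁ : IsFullLattice A L₁) :
    Finite (Quot fun L L' : {L₂ : Submodule ℤ A //
        IsFullLattice A L₂ ∧ (1 : A) ∈ (L₁ / L₂) * (L₂ / L₁)} => ∃ u : Aˣ, u • L.1 = L'.1) := by
  obtain ⟨e⟩ := nonempty_equiv_quot_weak hL₁
  haveI := finite_quot_invertible (isFullLattice_div hL₁ hL₁)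
  exact Finite.of_equiv _ e

end WeakClass

end Literature.NumberTheory.ComplexMultiplication.FiniteQAlgebraLattice
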